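import Mathlib.Analysis.Complex.Exponential
import Literature.NumberTheory.Sieve.CoprimeSquarefreeSumsBounds
import HarnessLib

/-!
# NE7SliceIterationContractionArith — THE REAL ARITHMETIC OF THE (S1) CONTRACTION (memo ROAD-G100 §2.7 item F4, fourth file): the defect bound of `NE7SliceIterationStep.sliceDefect_sliceStep_le`
# (with `δ := Df`, `σ := 6dM·Df` and `e_E, c_E` at their floors) is `≤ C·τ·Df` when `M·s, M·Df, η, M²x, M²x′ ≤ τ ≤ 1` and `cruxC·M²x ≤ 1∕2`, with
# `C := 3·10⁶·(1+16K)(1+d)³(1+frameC)(1+supC+supCurlC)` — hence a contraction by `1∕2` once `C·τ ≤ 1∕2`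

Cell `pub-balaban`, rung (B)+1 sub-cell t4, lineage `b2b-balaban-t4-ne7-p1`, generation 101 (CRUX PROVER NE7 #1 = OWNER of BINDER row NE7).  Memo `t4/b2b-balaban-t4-ne7-p1-g101/ROAD-G101.md` §7.
Pure real inequalities; the letters are real parameters here (`dd = d`, `M = L^{k+1}`, `K` the curved sup letter constant, `fC = frameC`, `sC = supC`, `sCC = supCurlC`, `θc = cruxC·M²x`).
WHAT ([folklore]; 0 def, 0 sorry; `e^y − 1 ≤ 2y` reused from `Literature.NumberTheory.Sieve.SquarefreeSums`).  `eJ_le`, `ecM_le`, `ephiM_le`, `eE_le`, `twoKM_cJ_le`, `twoKM_cE_le`; **`step_bound_le`** (the full bound `≤ C·τ·Df`);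
**`step_bound_le_half`** (`≤ Df∕2` for `C·τ ≤ 1∕2`).
HONEST FRAMING (page 1): arithmetic only; nothing of Bałaban's asserted; NOT (S1), NOT NE7; spine 0∕9; finite T⁴ rung (B)+1 — NOT infinite volume, NOT mass gap, NOT BetaPertH, NOT Clay.  Continuum YM on
T⁴ ⇐ BetaPertH ∧ nine spine estimates (0/9 proved); BetaPertH ⇐ (D1) ∧ (D4) ∧ CAP+tail; G-an2-4 gates asym, D1 and NE2/3/4.
-/

set_option autoImplicit false

namespace Summit.QuantumFields.BalabanUV.T4Continuum.NE7SliceIterationContractionArith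

open Literature.NumberTheory.Sieve.SquarefreeSums (exp_sub_one_le_two_mul)

section Arith

variable {dd M K fC sC sCC s η D x x' θc τ : ℝ}
  (hdd : 1 ≤ dd) (hM : 1 ≤ M) (hK : 0 ≤ K) (hfC : 0 ≤ fC) (hsC : 0 ≤ sC) (hsCC : 0 ≤ sCC)
  (hs : 0 ≤ s) (hη : 0 ≤ η) (hD : 0 ≤ D) (hx : 0 ≤ x) (hx' : 0 ≤ x') (hθc0 : 0 ≤ θc) (hθc : θc ≤ 1 / 2) (hτ0 : 0 ≤ τ) (hτ1 : τ ≤ 1)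
  (h1 : M * s ≤ τ) (h2 : M * D ≤ τ) (h3 : η ≤ τ) (h4 : M ^ 2 * x ≤ τ) (h5 : M ^ 2 * x' ≤ τ)

include hdd hM hs hD hτ0 h1 h2 in
/-- **`e_J ≤ 30000·d·τ·Df`** (`e_J = 16384·Df·s + 2048·σ·Df + 6σs`, `σ = 6dM·Df`). [folklore] -/
theorem eJ_le : 16384 * D * s + 2048 * (6 * dd * M * D) * D + 6 * (6 * dd * M * D) * s ≤ 30000 * dd * τ * D := by
  have hs' : s ≤ τ := by nlinarith
  have a1 : 16384 * D * s ≤ 16384 * τ * D := by nlinarith [mul_le_mul_of_nonneg_left hs' hD]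
  have a2 : 2048 * (6 * dd * M * D) * D ≤ 12288 * dd * τ * D := by
    have := mul_le_mul_of_nonneg_left h2 (mul_nonneg (by linarith : (0:ℝ) ≤ dd) hD)
    nlinarith
  have a3 : 6 * (6 * dd * M * D) * s ≤ 36 * dd * τ * D := by
    have := mul_le_mul_of_nonneg_left h1 (mul_nonneg (by linarith : (0:ℝ) ≤ dd) hD)
    nlinarith
  nlinarith [mul_nonneg hτ0 hD, mul_nonneg (mul_nonneg (by linarith : (0:ℝ) ≤ dd - 1) hτ0) hD]

include hdd hM hD h3 in
/-- **`e_c∕M ≤ 24576·d·τ·Df`** (`e_c = 4096·σ·η`). [folklore] -/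
theorem ecM_le : 4096 * (6 * dd * M * D) * η / M ≤ 24576 * dd * τ * D := by
  have hM0 : 0 < M := by linarith
  rw [div_le_iff₀ hM0]
  have := mul_le_mul_of_nonneg_left h3 (mul_nonneg (mul_nonneg (by linarith : (0:ℝ) ≤ dd) hD) hM0.le)
  nlinarith

include hdd hM hs hD hτ0 h1 h2 h3 in
/-- **`e_φ∕M ≤ 5·10⁵·d²·τ·Df`** (`e_φ = (3+12d)·M·e_J + 2e_c`). [folklore] -/
theorem ephiM_le : ((3 + 12 * dd) * M * (16384 * D * s + 2048 * (6 * dd * M * D) * D + 6 * (6 * dd * M * D) * s) + 2 * (4096 * (6 * dd * M * D) * η)) / M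
    ≤ 500000 * dd ^ 2 * τ * D := by
  have hM0 : 0 < M := by linarith
  have hJ := eJ_le hdd hM hs hD hτ0 h1 h2
  have hc := ecM_le hdd hM hD h3
  rw [div_le_iff₀ hM0] at hc ⊢
  have hJ' := mul_le_mul_of_nonneg_left hJ (by nlinarith : (0:ℝ) ≤ (3 + 12 * dd) * M)
  have hτD : 0 ≤ τ * D := mul_nonneg hτ0 hD
  nlinarith [mul_nonneg (mul_nonneg (by linarith : (0:ℝ) ≤ dd - 1) hτD) hM0.le, mul_nonneg (mul_nonneg (mul_nonneg (by linarith : (0:ℝ) ≤ dd) (by linarith : (0:ℝ) ≤ dd - 1)) hτD) hM0.le]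

include hdd hM hsC hs hη hD hθc hτ0 h1 h2 h3 in
/-- **`e_E ≤ 10⁶·(1+supC)·d²·τ·Df`** at the floor `e_E = e_J + supC∕(M(1−θc))·e_φ`. [folklore] -/
theorem eE_le : (16384 * D * s + 2048 * (6 * dd * M * D) * D + 6 * (6 * dd * M * D) * s)
      + sC / (M * (1 - θc)) * ((3 + 12 * dd) * M * (16384 * D * s + 2048 * (6 * dd * M * D) * D + 6 * (6 * dd * M * D) * s) + 2 * (4096 * (6 * dd * M * D) * η))
    ≤ 1000000 * (1 + sC) * dd ^ 2 * τ * D := by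
  have hM0 : 0 < M := by linarith
  have h1θ : 1 / 2 ≤ 1 - θc := by linarith
  have hJ := eJ_le hdd hM hs hD hτ0 h1 h2
  have hφ := ephiM_le hdd hM hs hD hτ0 h1 h2 h3
  have hφ0 : 0 ≤ ((3 + 12 * dd) * M * (16384 * D * s + 2048 * (6 * dd * M * D) * D + 6 * (6 * dd * M * D) * s) + 2 * (4096 * (6 * dd * M * D) * η)) := by
    have : 0 ≤ dd := by linarith
    positivity
  -- `sC/(M(1−θc))·e_φ ≤ 2 sC · (e_φ/M)`
  have hfrac : sC / (M * (1 - θc)) * ((3 + 12 * dd) * M * (16384 * D * s + 2048 * (6 * dd * M * D) * D + 6 * (6 * dd * M * D) * s) + 2 * (4096 * (6 * dd * M * D) * η))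
      ≤ 2 * sC * (500000 * dd ^ 2 * τ * D) := by
    rw [div_mul_eq_mul_div, div_le_iff₀ (by positivity)]
    have hφM : ((3 + 12 * dd) * M * (16384 * D * s + 2048 * (6 * dd * M * D) * D + 6 * (6 * dd * M * D) * s) + 2 * (4096 * (6 * dd * M * D) * η))
        ≤ 500000 * dd ^ 2 * τ * D * M := by
      have h := hφ
      rwa [div_le_iff₀ hM0] at h
    have hB0 : (0:ℝ) ≤ 500000 * dd ^ 2 * τ * D := by positivity
    nlinarith [mul_le_mul_of_nonneg_left hφM hsC, mul_nonneg (mul_nonneg hsC hB0) hM0.le]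
  have hτD : 0 ≤ τ * D := mul_nonneg hτ0 hD
  nlinarith [mul_nonneg (by linarith : (0:ℝ) ≤ dd - 1) (mul_nonneg (by linarith : (0:ℝ) ≤ dd) hτD), mul_nonneg hsC (mul_nonneg (by nlinarith : (0:ℝ) ≤ dd ^ 2) hτD),
    mul_nonneg (by linarith : (0:ℝ) ≤ dd) hτD]

include hdd hM hK hs hD hτ0 h1 h2 h4 h5 in
/-- **`2KM·c_J ≤ 456·K·d·τ·Df`** (`c_J = 2(2σ)x′ + 4(e^{4(s+Df+e_J)} − 1)(Df + e_J) + 2xσ`; needs `30000·d·τ ≤ 1` so that `e_J ≤ Df` and `4ρ ≤ 1`). [folklore] -/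
theorem twoKM_cJ_le (hτs : 30000 * dd * τ ≤ 1) :
    2 * K * M * (2 * (2 * (6 * dd * M * D)) * x' + 4 * (Real.exp (4 * (s + D + (16384 * D * s + 2048 * (6 * dd * M * D) * D + 6 * (6 * dd * M * D) * s))) - 1)
        * (D + (16384 * D * s + 2048 * (6 * dd * M * D) * D + 6 * (6 * dd * M * D) * s)) + 2 * x * (6 * dd * M * D))
      ≤ 456 * K * dd * τ * D := by
  have hM0 : 0 < M := by linarith
  have hJ := eJ_le hdd hM hs hD hτ0 h1 h2
  have heJ0 : 0 ≤ 16384 * D * s + 2048 * (6 * dd * M * D) * D + 6 * (6 * dd * M * D) * s := by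
    have : 0 ≤ dd := by linarith
    positivity
  have heJD : 16384 * D * s + 2048 * (6 * dd * M * D) * D + 6 * (6 * dd * M * D) * s ≤ D := by
    nlinarith [mul_le_mul_of_nonneg_right hτs hD]
  -- `ρ := s + D + e_J ≤ s + 2D`, `4ρ ≤ 1`, `M·ρ ≤ 3τ`
  have hs' : s ≤ τ := by nlinarith
  have hD' : D ≤ τ := by nlinarith
  have hρ1 : 4 * (s + D + (16384 * D * s + 2048 * (6 * dd * M * D) * D + 6 * (6 * dd * M * D) * s)) ≤ 1 := by
    nlinarith
  have hρ0 : 0 ≤ 4 * (s + D + (16384 * D * s + 2048 * (6 * dd * M * D) * D + 6 * (6 * dd * M * D) * s)) := by positivity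
  have hexp := exp_sub_one_le_two_mul hρ0 hρ1
  -- the three pieces
  have p1 : 2 * K * M * (2 * (2 * (6 * dd * M * D)) * x') ≤ 48 * K * dd * τ * D := by
    have := mul_le_mul_of_nonneg_left h5 (mul_nonneg (mul_nonneg hK (by linarith : (0:ℝ) ≤ dd)) hD)
    nlinarith
  have p3 : 2 * K * M * (2 * x * (6 * dd * M * D)) ≤ 24 * K * dd * τ * D := by
    have := mul_le_mul_of_nonneg_left h4 (mul_nonneg (mul_nonneg hK (by linarith : (0:ℝ) ≤ dd)) hD)
    nlinarith
  have p2 : 2 * K * M * (4 * (Real.exp (4 * (s + D + (16384 * D * s + 2048 * (6 * dd * M * D) * D + 6 * (6 * dd * M * D) * s))) - 1)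
        * (D + (16384 * D * s + 2048 * (6 * dd * M * D) * D + 6 * (6 * dd * M * D) * s))) ≤ 384 * K * τ * D := by
    -- `exp − 1 ≤ 8ρ ≤ 8(s + 2D)`, `D + e_J ≤ 2D`, `M(s+2D) ≤ 3τ`
    have hq : Real.exp (4 * (s + D + (16384 * D * s + 2048 * (6 * dd * M * D) * D + 6 * (6 * dd * M * D) * s))) - 1 ≤ 8 * (s + 2 * D) := by
      nlinarith
    have hq0 : 0 ≤ Real.exp (4 * (s + D + (16384 * D * s + 2048 * (6 * dd * M * D) * D + 6 * (6 * dd * M * D) * s))) - 1 := by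
      have := Real.add_one_le_exp (4 * (s + D + (16384 * D * s + 2048 * (6 * dd * M * D) * D + 6 * (6 * dd * M * D) * s)))
      linarith
    have hr : D + (16384 * D * s + 2048 * (6 * dd * M * D) * D + 6 * (6 * dd * M * D) * s) ≤ 2 * D := by linarith
    have hprod : (Real.exp (4 * (s + D + (16384 * D * s + 2048 * (6 * dd * M * D) * D + 6 * (6 * dd * M * D) * s))) - 1)
        * (D + (16384 * D * s + 2048 * (6 * dd * M * D) * D + 6 * (6 * dd * M * D) * s)) ≤ 8 * (s + 2 * D) * (2 * D) :=
      mul_le_mul hq hr (by positivity) (by positivity)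
    have hM3 : M * (s + 2 * D) ≤ 3 * τ := by nlinarith
    have := mul_le_mul_of_nonneg_left hprod (by positivity : (0:ℝ) ≤ 2 * K * M * 4)
    nlinarith [mul_le_mul_of_nonneg_left hM3 (mul_nonneg hK hD)]
  have e : 2 * K * M * (2 * (2 * (6 * dd * M * D)) * x' + 4 * (Real.exp (4 * (s + D + (16384 * D * s + 2048 * (6 * dd * M * D) * D + 6 * (6 * dd * M * D) * s))) - 1)
        * (D + (16384 * D * s + 2048 * (6 * dd * M * D) * D + 6 * (6 * dd * M * D) * s)) + 2 * x * (6 * dd * M * D))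
      = 2 * K * M * (2 * (2 * (6 * dd * M * D)) * x') + 2 * K * M * (4 * (Real.exp (4 * (s + D + (16384 * D * s + 2048 * (6 * dd * M * D) * D + 6 * (6 * dd * M * D) * s))) - 1)
        * (D + (16384 * D * s + 2048 * (6 * dd * M * D) * D + 6 * (6 * dd * M * D) * s))) + 2 * K * M * (2 * x * (6 * dd * M * D)) := by ring
  rw [e]
  nlinarith [mul_nonneg (mul_nonneg hK hτ0) hD, mul_nonneg (mul_nonneg (mul_nonneg hK (by linarith : (0:ℝ) ≤ dd - 1)) hτ0) hD]

include hdd hM hK hsCC hs hη hD hθc hτ0 h1 h2 h3 h4 h5 in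
/-- **`2KM·c_E ≤ 2·10⁶·K(1+supCurlC)·d²·τ·Df`** at the floor `c_E = c_J + supCurlC∕(M²(1−θc))·e_φ`. [folklore] -/
theorem twoKM_cE_le (hτs : 30000 * dd * τ ≤ 1) :
    2 * K * M * ((2 * (2 * (6 * dd * M * D)) * x' + 4 * (Real.exp (4 * (s + D + (16384 * D * s + 2048 * (6 * dd * M * D) * D + 6 * (6 * dd * M * D) * s))) - 1)
        * (D + (16384 * D * s + 2048 * (6 * dd * M * D) * D + 6 * (6 * dd * M * D) * s)) + 2 * x * (6 * dd * M * D))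
      + sCC / (M ^ 2 * (1 - θc)) * ((3 + 12 * dd) * M * (16384 * D * s + 2048 * (6 * dd * M * D) * D + 6 * (6 * dd * M * D) * s) + 2 * (4096 * (6 * dd * M * D) * η)))
      ≤ 2000000 * K * (1 + sCC) * dd ^ 2 * τ * D := by
  have hM0 : 0 < M := by linarith
  have h1θ : 1 / 2 ≤ 1 - θc := by linarith
  have hcJ := twoKM_cJ_le hdd hM hK hs hD hτ0 h1 h2 h4 h5 hτs
  have hφ := ephiM_le hdd hM hs hD hτ0 h1 h2 h3
  have hφ0 : 0 ≤ ((3 + 12 * dd) * M * (16384 * D * s + 2048 * (6 * dd * M * D) * D + 6 * (6 * dd * M * D) * s) + 2 * (4096 * (6 * dd * M * D) * η)) := by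
    have : 0 ≤ dd := by linarith
    positivity
  -- `2KM · sCC/(M²(1−θc)) · e_φ ≤ 4 K sCC · (e_φ/M)`
  have hfrac : 2 * K * M * (sCC / (M ^ 2 * (1 - θc)) * ((3 + 12 * dd) * M * (16384 * D * s + 2048 * (6 * dd * M * D) * D + 6 * (6 * dd * M * D) * s) + 2 * (4096 * (6 * dd * M * D) * η)))
      ≤ 4 * K * sCC * (500000 * dd ^ 2 * τ * D) := by
    have hle : sCC / (M ^ 2 * (1 - θc)) ≤ 2 * sCC / M ^ 2 := by
      rw [div_le_div_iff₀ (by positivity) (by positivity)]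
      nlinarith [mul_nonneg hsCC (by positivity : (0:ℝ) ≤ M ^ 2)]
    have hφ' : ((3 + 12 * dd) * M * (16384 * D * s + 2048 * (6 * dd * M * D) * D + 6 * (6 * dd * M * D) * s) + 2 * (4096 * (6 * dd * M * D) * η))
        ≤ M * (500000 * dd ^ 2 * τ * D) := by
      have h := hφ
      rw [div_le_iff₀ hM0] at h
      linarith [h, mul_comm M (500000 * dd ^ 2 * τ * D)]
    calc 2 * K * M * (sCC / (M ^ 2 * (1 - θc)) * ((3 + 12 * dd) * M * (16384 * D * s + 2048 * (6 * dd * M * D) * D + 6 * (6 * dd * M * D) * s) + 2 * (4096 * (6 * dd * M * D) * η)))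
        ≤ 2 * K * M * (2 * sCC / M ^ 2 * (M * (500000 * dd ^ 2 * τ * D))) := by
          apply mul_le_mul_of_nonneg_left _ (by positivity)
          exact mul_le_mul hle hφ' hφ0 (by positivity)
      _ = 4 * K * sCC * (500000 * dd ^ 2 * τ * D) := by field_simp; ring
  rw [mul_add]
  have hτD : 0 ≤ τ * D := mul_nonneg hτ0 hD
  nlinarith [mul_nonneg hK (mul_nonneg (by linarith : (0:ℝ) ≤ dd - 1) (mul_nonneg (by linarith : (0:ℝ) ≤ dd) hτD)),
    mul_nonneg hK (mul_nonneg (by nlinarith : (0:ℝ) ≤ dd ^ 2) hτD), mul_nonneg (mul_nonneg hK hsCC) (mul_nonneg (by nlinarith : (0:ℝ) ≤ dd ^ 2) hτD)]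

include hdd hM hK hfC hsC hsCC hD hx hτ0 hτ1 h4 in
/-- **THE STEP BOUND**: with `e_E ≤ 10⁶(1+supC)d²·τ·Df`, `2KM·c_E ≤ 2·10⁶K(1+supCurlC)d²·τ·Df`, `e_c∕M ≤ 24576·d·τ·Df` (the three floors above), the defect bound of
`NE7SliceIterationStep.sliceDefect_sliceStep_le` is `≤ 3·10⁶(1+16K)(1+d)³(1+frameC)(1+supC+supCurlC)·τ·Df`. [folklore] -/
theorem step_bound_le {eE cE ec : ℝ} (heE0 : 0 ≤ eE) (hec0 : 0 ≤ ec)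
    (heEb : eE ≤ 1000000 * (1 + sC) * dd ^ 2 * τ * D) (hcEb : 2 * K * M * cE ≤ 2000000 * K * (1 + sCC) * dd ^ 2 * τ * D) (hecb : ec / M ≤ 24576 * dd * τ * D) :
    (eE + (2 * K * M * cE + 8 * K * (M ^ 2 * x) * (fC * M * eE + ec) / M + 16 * K * dd * (M ^ 2 * x) * eE)) + (fC * M * eE + ec) / M
      ≤ 3000000 * (1 + 16 * K) * (1 + dd) ^ 3 * (1 + fC) * (1 + sC + sCC) * τ * D := by
  have hM0 : 0 < M := by linarith
  have hd0 : 0 ≤ dd := by linarith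
  have e1 : (fC * M * eE + ec) / M = fC * eE + ec / M := by field_simp
  have e2 : 8 * K * (M ^ 2 * x) * (fC * M * eE + ec) / M = 8 * K * (M ^ 2 * x) * (fC * eE + ec / M) := by field_simp
  rw [e1, e2]
  have hecM0 : 0 ≤ ec / M := div_nonneg hec0 hM0.le
  have hMx1 : M ^ 2 * x ≤ 1 := h4.trans hτ1
  have hMx0 : 0 ≤ M ^ 2 * x := by positivity
  -- drop the factors `M²x ≤ 1`
  have a1 : 8 * K * (M ^ 2 * x) * (fC * eE + ec / M) ≤ 8 * K * (fC * eE + ec / M) := by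
    have h0 : 0 ≤ 8 * K * (fC * eE + ec / M) := by positivity
    have := mul_le_mul_of_nonneg_left hMx1 h0
    linarith only [this]
  have a2 : 16 * K * dd * (M ^ 2 * x) * eE ≤ 16 * K * dd * eE := by
    have h0 : 0 ≤ 16 * K * dd * eE := by positivity
    have := mul_le_mul_of_nonneg_left hMx1 h0
    linarith only [this]
  -- collect: `≤ (1 + fC + 8KfC + 16Kd)·eE + (1 + 8K)·(ec/M) + 2KM·cE`
  have hτD : 0 ≤ τ * D := mul_nonneg hτ0 hD
  obtain ⟨P, hP⟩ : ∃ P : ℝ, P = (1 + 16 * K) * (1 + dd) ^ 3 * (1 + fC) * (1 + sC + sCC) := ⟨_, rfl⟩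
  have hP0 : 0 ≤ P := by rw [hP]; positivity
  have hP1 : (1 + fC) * (1 + 16 * K) * (1 + dd) * ((1 + sC + sCC) * (1 + dd) ^ 2) = P := by rw [hP]; ring
  -- term 1
  have t1a : 1 + fC + 8 * K * fC + 16 * K * dd ≤ (1 + fC) * (1 + 16 * K) * (1 + dd) := by
    nlinarith only [hK, hfC, hd0, mul_nonneg hK hfC, mul_nonneg hK hd0, mul_nonneg hfC hd0, mul_nonneg (mul_nonneg hK hfC) hd0]
  have t1b : (1 + sC) * dd ^ 2 ≤ (1 + sC + sCC) * (1 + dd) ^ 2 := by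
    have : dd ^ 2 ≤ (1 + dd) ^ 2 := by nlinarith only [hd0]
    exact mul_le_mul (by linarith only [hsCC]) this (by positivity) (by positivity)
  have t1 : (1 + fC + 8 * K * fC + 16 * K * dd) * eE ≤ 1000000 * P * (τ * D) := by
    have h0 : 0 ≤ 1 + fC + 8 * K * fC + 16 * K * dd := by positivity
    calc (1 + fC + 8 * K * fC + 16 * K * dd) * eE ≤ (1 + fC + 8 * K * fC + 16 * K * dd) * (1000000 * (1 + sC) * dd ^ 2 * τ * D) :=
          mul_le_mul_of_nonneg_left heEb h0
      _ = 1000000 * ((1 + fC + 8 * K * fC + 16 * K * dd) * ((1 + sC) * dd ^ 2)) * (τ * D) := by ring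
      _ ≤ 1000000 * ((1 + fC) * (1 + 16 * K) * (1 + dd) * ((1 + sC + sCC) * (1 + dd) ^ 2)) * (τ * D) := by
          apply mul_le_mul_of_nonneg_right _ hτD
          apply mul_le_mul_of_nonneg_left _ (by norm_num)
          exact mul_le_mul t1a t1b (by positivity) (by positivity)
      _ = 1000000 * P * (τ * D) := by rw [hP1]
  -- term 2
  have hsq : (1 : ℝ) ≤ (1 + dd) ^ 2 := one_le_pow₀ (by linarith only [hd0])
  have hcube : dd ≤ (1 + dd) ^ 3 := by
    calc dd ≤ (1 + dd) * 1 := by linarith only [hd0]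
      _ ≤ (1 + dd) * (1 + dd) ^ 2 := mul_le_mul_of_nonneg_left hsq (by linarith only [hd0])
      _ = (1 + dd) ^ 3 := by ring
  have hcube2 : dd ^ 2 ≤ (1 + dd) ^ 3 := by
    have h1 : dd ^ 2 ≤ (1 + dd) ^ 2 := by nlinarith only [hd0]
    calc dd ^ 2 ≤ 1 * (1 + dd) ^ 2 := by linarith only [h1]
      _ ≤ (1 + dd) * (1 + dd) ^ 2 := mul_le_mul_of_nonneg_right (by linarith only [hd0]) (by positivity)
      _ = (1 + dd) ^ 3 := by ring
  have hPge : (1 + 8 * K) * dd ≤ P := by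
    rw [hP]
    have f1 : (1 + 8 * K) ≤ (1 + 16 * K) := by linarith only [hK]
    have f2 : dd ≤ (1 + dd) ^ 3 := hcube
    have f3 : (1 : ℝ) ≤ (1 + fC) := by linarith only [hfC]
    have f4 : (1 : ℝ) ≤ (1 + sC + sCC) := by linarith only [hsC, hsCC]
    calc (1 + 8 * K) * dd = (1 + 8 * K) * dd * 1 * 1 := by ring
      _ ≤ (1 + 16 * K) * (1 + dd) ^ 3 * (1 + fC) * (1 + sC + sCC) := by
          apply mul_le_mul (mul_le_mul (mul_le_mul f1 f2 hd0 (by positivity)) f3 zero_le_one (by positivity)) f4 zero_le_one (by positivity)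
  have t2 : (1 + 8 * K) * (ec / M) ≤ 1000000 * P * (τ * D) := by
    calc (1 + 8 * K) * (ec / M) ≤ (1 + 8 * K) * (24576 * dd * τ * D) := mul_le_mul_of_nonneg_left hecb (by positivity)
      _ = 24576 * ((1 + 8 * K) * dd) * (τ * D) := by ring
      _ ≤ 24576 * P * (τ * D) := mul_le_mul_of_nonneg_right (mul_le_mul_of_nonneg_left hPge (by norm_num)) hτD
      _ ≤ 1000000 * P * (τ * D) := mul_le_mul_of_nonneg_right (mul_le_mul_of_nonneg_right (by norm_num) hP0) hτD
  -- term 3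
  have hPge3 : 2 * K * (1 + sCC) * dd ^ 2 ≤ P := by
    rw [hP]
    have f1 : 2 * K ≤ (1 + 16 * K) := by linarith only [hK]
    have f2 : dd ^ 2 ≤ (1 + dd) ^ 3 := hcube2
    have f3 : (1 : ℝ) ≤ (1 + fC) := by linarith only [hfC]
    have f4 : (1 + sCC) ≤ (1 + sC + sCC) := by linarith only [hsC]
    calc 2 * K * (1 + sCC) * dd ^ 2 = 2 * K * dd ^ 2 * 1 * (1 + sCC) := by ring
      _ ≤ (1 + 16 * K) * (1 + dd) ^ 3 * (1 + fC) * (1 + sC + sCC) := by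
          apply mul_le_mul (mul_le_mul (mul_le_mul f1 f2 (by positivity) (by positivity)) f3 zero_le_one (by positivity)) f4 (by positivity) (by positivity)
  have t3 : 2 * K * M * cE ≤ 1000000 * P * (τ * D) := by
    calc 2 * K * M * cE ≤ 2000000 * K * (1 + sCC) * dd ^ 2 * τ * D := hcEb
      _ = 1000000 * (2 * K * (1 + sCC) * dd ^ 2) * (τ * D) := by ring
      _ ≤ 1000000 * P * (τ * D) := mul_le_mul_of_nonneg_right (mul_le_mul_of_nonneg_left hPge3 (by norm_num)) hτD
  have etot : 3000000 * (1 + 16 * K) * (1 + dd) ^ 3 * (1 + fC) * (1 + sC + sCC) * τ * D = 3 * (1000000 * P * (τ * D)) := by rw [hP]; ring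
  rw [etot]
  linarith only [a1, a2, t1, t2, t3]

include hdd hM hK hfC hsC hsCC hD hx hτ0 hτ1 h4 in
/-- **THE CONTRACTION BY ONE HALF**: under `3·10⁶(1+16K)(1+d)³(1+frameC)(1+supC+supCurlC)·τ ≤ 1∕2` the step bound is `≤ Df∕2`. [folklore] -/
theorem step_bound_le_half {eE cE ec : ℝ} (heE0 : 0 ≤ eE) (hec0 : 0 ≤ ec)
    (heEb : eE ≤ 1000000 * (1 + sC) * dd ^ 2 * τ * D) (hcEb : 2 * K * M * cE ≤ 2000000 * K * (1 + sCC) * dd ^ 2 * τ * D) (hecb : ec / M ≤ 24576 * dd * τ * D)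
    (hC : 3000000 * (1 + 16 * K) * (1 + dd) ^ 3 * (1 + fC) * (1 + sC + sCC) * τ ≤ 1 / 2) :
    (eE + (2 * K * M * cE + 8 * K * (M ^ 2 * x) * (fC * M * eE + ec) / M + 16 * K * dd * (M ^ 2 * x) * eE)) + (fC * M * eE + ec) / M ≤ D / 2 := by
  refine (step_bound_le hdd hM hK hfC hsC hsCC hD hx hτ0 hτ1 h4 heE0 hec0 heEb hcEb hecb).trans ?_
  have := mul_le_mul_of_nonneg_right hC hD
  linarith only [this]

end Arith

end Summit.QuantumFields.BalabanUV.T4Continuum.NE7SliceIterationContractionArith
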